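import Mathlib
import Summits.Ventures.HodgeRepro.Tier4.Line1.IsotypicHeckeAlgebra
import Summits.Ventures.HodgeRepro.Tier4.Line1.IsotypicBernsteinIso

/-!
# Tier4/Line1/IsotypicC2Instance — (C2) FOR THE TYPE-σ BLOCK: the constituents of the type-σ block are pairwise
non-isomorphic `H_σ`-modules from multiplicity one of their algebraic cores

Blind re-derivation cell `pub-hodge-repro`, Tier 4 (README §9–§10), seat t4-L1-p2 (gen 4), LINE L1; the type-σ
instance of the (C2) theorem of `IsotypicBernsteinIso` (p691785) on t4-L1-p3 g3's Hecke algebra of type σ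
(`IsotypicHeckeAlgebra`, p692571) — the twin of `isSimpleModule_isotypic` ((C1), p3) for (C2).  Target tree path
`lean/Summits/Ventures/HodgeRepro/Tier4/Line1/IsotypicC2Instance.lean`.  Imports p3's `IsotypicHeckeAlgebra`
(`HeckeAlg`, `instModuleHeckeAlg`, `hact_heckeAlg`, `hfull_heckeAlg`) and through it `IsotypicBlock`
(`isotypicFixed`, `mem_isotypicFixed`) and `IsotypicIdempotent` (`eσ`, `isTest_eσ`), and this seat's
`IsotypicBernsteinIso` (`hnon_of_multiplicityOne_core`).  0 print.

WHAT IS PROVED.  **`hnon_isotypic_of_multiplicityOne_core`**: for the type-σ block `Vb := isotypicFixed S K ρ hKo hKc hρ`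
over `H_σ := HeckeAlg S K ρ hKo hKc hρ hirr`, a family of invariant irreducible constituents `τ` and their
`H_σ`-submodules `W i = τ (idx i) ∩ Vb` (`hW`), MULTIPLICITY ONE OF THE CORES (`i ≠ j → ¬ IsoRep (core (W i))
(core (W j))`, DATA) gives the field `hnon : ∀ i j, i ≠ j → IsEmpty (W i ≃ₗ[H_σ] W j)` of p5's `IdempotentData` —
`hnon_of_multiplicityOne_core` with `e := eσ` (`isTest_eσ`), `hVb := mem_isotypicFixed`, `hact := hact_heckeAlg`
(rfl) and `hfull := hfull_heckeAlg` (p3's theorem; BlockSimple's displayed clause, discharged).  Displayed: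
`hinv`, `hirr` (= `IsAdaptedONB.inv/irred`), `hW`, `hM`; instances `[SecondCountableTopology G] [T2Space G]
[MeasurableMul G] [SFinite S.μ] [LocallyCompactSpace G]`.  With (C1) `isSimpleModule_isotypic` (p3) the two
constituent clauses of `IdempotentData.ofIsotypic` are theorems modulo the DATA `hM` and a non-zero vector.
REMARK (the `⊥` case): `hM` can only hold for a family in which at most one constituent has `W i = ⊥` (two zero
blocks have isomorphic zero cores), i.e. for the constituents of the BLOCK — the family `idx` of p5's data, whose
`W i ≠ ⊥` is the clause `(∃ ψ ∈ Vb, ψ ∈ τ m ∧ ψ ≠ 0) → m ∈ s` of (C-PROJ).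

Nothing here says anything about the status of the Hodge conjecture for CM abelian varieties, which is NOT proved
(HC_CM is NOT proved by anyone in this repository).
-/

set_option autoImplicit false

noncomputable section

namespace Summit.Ventures.HodgeRepro.Tier4.Line1

open MeasureTheory Topology

namespace RTF

namespace Setting

variable {G : Type} [Group G] [TopologicalSpace G] [IsTopologicalGroup G] [MeasurableSpace G] [BorelSpace G]
  (S : Setting G) (K : Subgroup G) {d : ℕ} (ρ : K →* Matrix (Fin d) (Fin d) ℂ)
  (hKo : IsOpen (K : Set G)) (hKc : IsCompact (K : Set G)) (hρ : Continuous ρ) (hirr : IsIrreducibleRep ρ)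
  [SecondCountableTopology G] [T2Space G] [MeasurableMul G] [SFinite S.μ] [LocallyCompactSpace G]

/-- **(C2) for the type-σ block**: the constituents `W i = τ (idx i) ∩ Vb` of a family of invariant irreducible
`τ` are pairwise non-isomorphic `H_σ`-modules as soon as their algebraic cores are pairwise non-isomorphic
representations (multiplicity one of the cores, DISPLAYED) — `hfull` / `hact` are p3's theorems. -/
theorem hnon_isotypic_of_multiplicityOne_core {ι : Type} {τ : ℕ → Set (G → ℂ)}
    (hinv : ∀ m, S.IsInvariantSubspace (τ m)) (hirr' : ∀ m, S.IsIrreducible (τ m)) {idx : ι → ℕ}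
    {W : ι → Submodule (HeckeAlg S K ρ hKo hKc hρ hirr) (isotypicFixed S K ρ hKo hKc hρ)}
    (hW : ∀ (i : ι) (ψ : isotypicFixed S K ρ hKo hKc hρ), ψ ∈ W i ↔ (ψ : G → ℂ) ∈ τ (idx i))
    (hM : ∀ i j : ι, i ≠ j → ¬ S.IsoRep (S.core (W i)) (S.core (W j))) :
    ∀ i j : ι, i ≠ j → IsEmpty ((W i) ≃ₗ[HeckeAlg S K ρ hKo hKc hρ hirr] (W j)) :=
  S.hnon_of_multiplicityOne_core (isTest_eσ S K ρ hKo hKc hρ) (mem_isotypicFixed S K ρ hKo hKc hρ)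
    (S.hact_heckeAlg K ρ hKo hKc hρ hirr) (fun _ hf => S.hfull_heckeAlg K ρ hKo hKc hρ hirr hf) hinv hirr' hW hM

end Setting

end RTF

end Summit.Ventures.HodgeRepro.Tier4.Line1

end
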